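import Summits.ValiantsHypothesis.ValiantsHypothesis.Theorems.KPlusLogSqLawTropicalBMarkedEdgeCorePairs

/-!
# Route «KPlusLogSqLaw», crux `TropicalB` (stmt-ValiantsHypothesis-19771) — MARKED-EDGE sector, NESTED-TRIANGLE CORE, ALL sizes, part 2:
# the three pairs with the cover of pattern {b0,b4}: ONE cycle, or TWO with `b0` split off

HONEST FRAMING.  Helper file (cell `pub-symmetroid`, seat val-sym-trop-p4 (g18), 2026-08-28; `--supports stmt-ValiantsHypothesis-19771 --as
helper`).  Continues part 1 (`…MarkedEdgeCorePairs`): all-`m` STRUCTURE of a would-be realisation of the nested-triangle core {1,2},{1,3},{2,3},{0,4}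
(kernel-impossible at m = 6, p664896; located-exact impossible m ≤ 8; OPEN for m ≥ 9).  Setting and «unique maximiser» verbatim as in part 1 /
the four-bit chain.  Nothing here proves the law; nothing concerns `TropicalB` in its window, `WeakLifting`, the doors, `MatrixDescartes`
(stmt-ValiantsHypothesis-18050) or VP ≠ VNP.

CONTENTS (`X ∈ {B, C, E}`, `π = σX⁻¹σZ`, marked fixed points of `σX` = `{bp, bq}` ⊂ {b1,b2,b3}): `core_BZ_structure`, `core_CZ_structure`,
`core_EZ_structure` — for every point `a` moved by `π`: EITHER `a` lies on the cycle of `π` through `b4`, `bp`, `bq`, OR `a` lies on the cycle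
through `b0` and that cycle avoids `b4`, `bp`, `bq`.  Hence `π` is a single cycle (through `b0, b4, bp, bq`) or has exactly two cycles, the one
through `b0` and the one through `b4 , bp, bq` (the mixed covers then have patterns `{b0,bp,bq}` and `{b4}`: slopes 7/11/13 and 16, the only
values strictly between slope `σX` and 17 — `Core.pair_dichotomy`).
-/

set_option linter.dupNamespace false
set_option autoImplicit false

namespace Summit.ValiantsHypothesis.ValiantsHypothesis.Theorems.KPlusLogSqLaw
namespace MarkedEdge
namespace Core

open Finset

variable {V : Type*} [Fintype V] [DecidableEq V]
variable (ok : V → V → Prop) (w g : V → V → ℤ) (b : Fin 5 → V)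

/-- slope of the mixed cover «`σ₂` on the cycle of `a`, `σ₁` elsewhere» in marked coordinates. [folklore] -/
theorem slope_mixed (hb : Function.Injective b)
    (hoff : ∀ i j, j ≠ i → g i j = 0) (hmark : ∀ l, g (b l) (b l) = (2 : ℤ) ^ (l : ℕ)) (haux : ∀ i, (∀ l, b l ≠ i) → g i i = 0)
    (σ₁ σ₂ : Equiv.Perm V) (a : V) :
    (∑ i, g i ((σ₁ * (σ₁⁻¹ * σ₂).cycleOf a) i)) =
      ∑ l : Fin 5, (if (if (σ₁⁻¹ * σ₂).SameCycle a (b l) then σ₂ (b l) else σ₁ (b l)) = b l then (2 : ℤ) ^ (l : ℕ) else 0) := by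
  rw [slope_eq_sum_marked g b hb hoff hmark haux]
  exact Finset.sum_congr rfl fun l _ => by rw [mixed_apply]

/-- **(B,Z) structure.**  Every point moved by `π = σB⁻¹σZ` lies on the cycle through `b4, b1, b2`, or on the cycle through `b0`, which then
avoids `b1, b2, b4`. [this seat's lemma] -/
theorem core_BZ_structure (hb : Function.Injective b)
    (hoff : ∀ i j, j ≠ i → g i j = 0) (hmark : ∀ l, g (b l) (b l) = (2 : ℤ) ^ (l : ℕ)) (haux : ∀ i, (∀ l, b l ≠ i) → g i i = 0)
    {θB θZ : ℤ} {σB σZ : Equiv.Perm V} (hθ : θB < θZ)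
    (hB : (∀ i, ok i (σB i)) ∧ ∀ τ : Equiv.Perm V, τ ≠ σB → (∀ i, ok i (τ i)) →
      ∑ i, (w i (τ i) + θB * g i (τ i)) < ∑ i, (w i (σB i) + θB * g i (σB i)))
    (hZ : (∀ i, ok i (σZ i)) ∧ ∀ τ : Equiv.Perm V, τ ≠ σZ → (∀ i, ok i (τ i)) →
      ∑ i, (w i (τ i) + θZ * g i (τ i)) < ∑ i, (w i (σZ i) + θZ * g i (σZ i)))
    (hB0 : σB (b 0) ≠ b 0) (hB1 : σB (b 1) = b 1) (hB2 : σB (b 2) = b 2) (hB3 : σB (b 3) ≠ b 3) (hB4 : σB (b 4) ≠ b 4)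
    (hZ0 : σZ (b 0) = b 0) (hZ1 : σZ (b 1) ≠ b 1) (hZ2 : σZ (b 2) ≠ b 2) (hZ3 : σZ (b 3) ≠ b 3) (hZ4 : σZ (b 4) = b 4)
    (a : V) (ha : (σB⁻¹ * σZ) a ≠ a) :
    ((σB⁻¹ * σZ).SameCycle a (b 4) ∧ (σB⁻¹ * σZ).SameCycle a (b 1) ∧ (σB⁻¹ * σZ).SameCycle a (b 2)) ∨
      ((σB⁻¹ * σZ).SameCycle a (b 0) ∧ ¬ (σB⁻¹ * σZ).SameCycle a (b 1) ∧ ¬ (σB⁻¹ * σZ).SameCycle a (b 2) ∧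
        ¬ (σB⁻¹ * σZ).SameCycle a (b 4)) := by
  have m1 : (σB⁻¹ * σZ) (b 1) ≠ b 1 := (rel_apply_ne_iff σB σZ (b 1)).mpr (by rw [hB1]; exact fun h => hZ1 h.symm)
  have m2 : (σB⁻¹ * σZ) (b 2) ≠ b 2 := (rel_apply_ne_iff σB σZ (b 2)).mpr (by rw [hB2]; exact fun h => hZ2 h.symm)
  have m4 : (σB⁻¹ * σZ) (b 4) ≠ b 4 := (rel_apply_ne_iff σB σZ (b 4)).mpr (by rw [hZ4]; exact hB4)
  rcases pair_dichotomy ok w g hθ hB hZ ha with hcyc | ⟨hlo, hhi⟩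
  · exact Or.inl ⟨sameCycle_of_cycleOf_eq hcyc m4, sameCycle_of_cycleOf_eq hcyc m1, sameCycle_of_cycleOf_eq hcyc m2⟩
  · rw [slope_B g b hb hoff hmark haux σB hB0 hB1 hB2 hB3 hB4] at hlo
    rw [slope_Z g b hb hoff hmark haux σZ hZ0 hZ1 hZ2 hZ3 hZ4] at hhi
    rw [slope_mixed g b hb hoff hmark haux, Fin.sum_univ_five] at hlo hhi
    by_cases c0 : (σB⁻¹ * σZ).SameCycle a (b 0) <;> by_cases c1 : (σB⁻¹ * σZ).SameCycle a (b 1) <;>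
      by_cases c2 : (σB⁻¹ * σZ).SameCycle a (b 2) <;> by_cases c3 : (σB⁻¹ * σZ).SameCycle a (b 3) <;>
        by_cases c4 : (σB⁻¹ * σZ).SameCycle a (b 4) <;>
          simp [c0, c1, c2, c3, c4, hB0, hB1, hB2, hB3, hB4, hZ0, hZ1, hZ2, hZ3, hZ4] at hlo hhi ⊢

/-- **(C,Z) structure.**  Every point moved by `π = σC⁻¹σZ` lies on the cycle through `b4, b1, b3`, or on the cycle through `b0`, which then
avoids `b1, b3, b4`. [this seat's lemma] -/
theorem core_CZ_structure (hb : Function.Injective b)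
    (hoff : ∀ i j, j ≠ i → g i j = 0) (hmark : ∀ l, g (b l) (b l) = (2 : ℤ) ^ (l : ℕ)) (haux : ∀ i, (∀ l, b l ≠ i) → g i i = 0)
    {θC θZ : ℤ} {σC σZ : Equiv.Perm V} (hθ : θC < θZ)
    (hC : (∀ i, ok i (σC i)) ∧ ∀ τ : Equiv.Perm V, τ ≠ σC → (∀ i, ok i (τ i)) →
      ∑ i, (w i (τ i) + θC * g i (τ i)) < ∑ i, (w i (σC i) + θC * g i (σC i)))
    (hZ : (∀ i, ok i (σZ i)) ∧ ∀ τ : Equiv.Perm V, τ ≠ σZ → (∀ i, ok i (τ i)) →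
      ∑ i, (w i (τ i) + θZ * g i (τ i)) < ∑ i, (w i (σZ i) + θZ * g i (σZ i)))
    (hC0 : σC (b 0) ≠ b 0) (hC1 : σC (b 1) = b 1) (hC2 : σC (b 2) ≠ b 2) (hC3 : σC (b 3) = b 3) (hC4 : σC (b 4) ≠ b 4)
    (hZ0 : σZ (b 0) = b 0) (hZ1 : σZ (b 1) ≠ b 1) (hZ2 : σZ (b 2) ≠ b 2) (hZ3 : σZ (b 3) ≠ b 3) (hZ4 : σZ (b 4) = b 4)
    (a : V) (ha : (σC⁻¹ * σZ) a ≠ a) :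
    ((σC⁻¹ * σZ).SameCycle a (b 4) ∧ (σC⁻¹ * σZ).SameCycle a (b 1) ∧ (σC⁻¹ * σZ).SameCycle a (b 3)) ∨
      ((σC⁻¹ * σZ).SameCycle a (b 0) ∧ ¬ (σC⁻¹ * σZ).SameCycle a (b 1) ∧ ¬ (σC⁻¹ * σZ).SameCycle a (b 3) ∧
        ¬ (σC⁻¹ * σZ).SameCycle a (b 4)) := by
  have m1 : (σC⁻¹ * σZ) (b 1) ≠ b 1 := (rel_apply_ne_iff σC σZ (b 1)).mpr (by rw [hC1]; exact fun h => hZ1 h.symm)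
  have m3 : (σC⁻¹ * σZ) (b 3) ≠ b 3 := (rel_apply_ne_iff σC σZ (b 3)).mpr (by rw [hC3]; exact fun h => hZ3 h.symm)
  have m4 : (σC⁻¹ * σZ) (b 4) ≠ b 4 := (rel_apply_ne_iff σC σZ (b 4)).mpr (by rw [hZ4]; exact hC4)
  rcases pair_dichotomy ok w g hθ hC hZ ha with hcyc | ⟨hlo, hhi⟩
  · exact Or.inl ⟨sameCycle_of_cycleOf_eq hcyc m4, sameCycle_of_cycleOf_eq hcyc m1, sameCycle_of_cycleOf_eq hcyc m3⟩
  · rw [slope_C g b hb hoff hmark haux σC hC0 hC1 hC2 hC3 hC4] at hlo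
    rw [slope_Z g b hb hoff hmark haux σZ hZ0 hZ1 hZ2 hZ3 hZ4] at hhi
    rw [slope_mixed g b hb hoff hmark haux, Fin.sum_univ_five] at hlo hhi
    by_cases c0 : (σC⁻¹ * σZ).SameCycle a (b 0) <;> by_cases c1 : (σC⁻¹ * σZ).SameCycle a (b 1) <;>
      by_cases c2 : (σC⁻¹ * σZ).SameCycle a (b 2) <;> by_cases c3 : (σC⁻¹ * σZ).SameCycle a (b 3) <;>
        by_cases c4 : (σC⁻¹ * σZ).SameCycle a (b 4) <;>
          simp [c0, c1, c2, c3, c4, hC0, hC1, hC2, hC3, hC4, hZ0, hZ1, hZ2, hZ3, hZ4] at hlo hhi ⊢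

/-- **(E,Z) structure.**  Every point moved by `π = σE⁻¹σZ` lies on the cycle through `b4, b2, b3`, or on the cycle through `b0`, which then
avoids `b2, b3, b4`. [this seat's lemma] -/
theorem core_EZ_structure (hb : Function.Injective b)
    (hoff : ∀ i j, j ≠ i → g i j = 0) (hmark : ∀ l, g (b l) (b l) = (2 : ℤ) ^ (l : ℕ)) (haux : ∀ i, (∀ l, b l ≠ i) → g i i = 0)
    {θE θZ : ℤ} {σE σZ : Equiv.Perm V} (hθ : θE < θZ)
    (hE : (∀ i, ok i (σE i)) ∧ ∀ τ : Equiv.Perm V, τ ≠ σE → (∀ i, ok i (τ i)) →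
      ∑ i, (w i (τ i) + θE * g i (τ i)) < ∑ i, (w i (σE i) + θE * g i (σE i)))
    (hZ : (∀ i, ok i (σZ i)) ∧ ∀ τ : Equiv.Perm V, τ ≠ σZ → (∀ i, ok i (τ i)) →
      ∑ i, (w i (τ i) + θZ * g i (τ i)) < ∑ i, (w i (σZ i) + θZ * g i (σZ i)))
    (hE0 : σE (b 0) ≠ b 0) (hE1 : σE (b 1) ≠ b 1) (hE2 : σE (b 2) = b 2) (hE3 : σE (b 3) = b 3) (hE4 : σE (b 4) ≠ b 4)
    (hZ0 : σZ (b 0) = b 0) (hZ1 : σZ (b 1) ≠ b 1) (hZ2 : σZ (b 2) ≠ b 2) (hZ3 : σZ (b 3) ≠ b 3) (hZ4 : σZ (b 4) = b 4)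
    (a : V) (ha : (σE⁻¹ * σZ) a ≠ a) :
    ((σE⁻¹ * σZ).SameCycle a (b 4) ∧ (σE⁻¹ * σZ).SameCycle a (b 2) ∧ (σE⁻¹ * σZ).SameCycle a (b 3)) ∨
      ((σE⁻¹ * σZ).SameCycle a (b 0) ∧ ¬ (σE⁻¹ * σZ).SameCycle a (b 2) ∧ ¬ (σE⁻¹ * σZ).SameCycle a (b 3) ∧
        ¬ (σE⁻¹ * σZ).SameCycle a (b 4)) := by
  have m2 : (σE⁻¹ * σZ) (b 2) ≠ b 2 := (rel_apply_ne_iff σE σZ (b 2)).mpr (by rw [hE2]; exact fun h => hZ2 h.symm)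
  have m3 : (σE⁻¹ * σZ) (b 3) ≠ b 3 := (rel_apply_ne_iff σE σZ (b 3)).mpr (by rw [hE3]; exact fun h => hZ3 h.symm)
  have m4 : (σE⁻¹ * σZ) (b 4) ≠ b 4 := (rel_apply_ne_iff σE σZ (b 4)).mpr (by rw [hZ4]; exact hE4)
  rcases pair_dichotomy ok w g hθ hE hZ ha with hcyc | ⟨hlo, hhi⟩
  · exact Or.inl ⟨sameCycle_of_cycleOf_eq hcyc m4, sameCycle_of_cycleOf_eq hcyc m2, sameCycle_of_cycleOf_eq hcyc m3⟩
  · rw [slope_E g b hb hoff hmark haux σE hE0 hE1 hE2 hE3 hE4] at hlo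
    rw [slope_Z g b hb hoff hmark haux σZ hZ0 hZ1 hZ2 hZ3 hZ4] at hhi
    rw [slope_mixed g b hb hoff hmark haux, Fin.sum_univ_five] at hlo hhi
    by_cases c0 : (σE⁻¹ * σZ).SameCycle a (b 0) <;> by_cases c1 : (σE⁻¹ * σZ).SameCycle a (b 1) <;>
      by_cases c2 : (σE⁻¹ * σZ).SameCycle a (b 2) <;> by_cases c3 : (σE⁻¹ * σZ).SameCycle a (b 3) <;>
        by_cases c4 : (σE⁻¹ * σZ).SameCycle a (b 4) <;>
          simp [c0, c1, c2, c3, c4, hE0, hE1, hE2, hE3, hE4, hZ0, hZ1, hZ2, hZ3, hZ4] at hlo hhi ⊢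

end Core
end MarkedEdge
end Summit.ValiantsHypothesis.ValiantsHypothesis.Theorems.KPlusLogSqLaw
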